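import Literature.LinearAlgebra.Matrix.PermanentBooleanSumScheme
import Mathlib.Tactic.FinCases
import Mathlib.Tactic.Abel
import HarnessLib

/-!
# The factor kit: read-once permanent blocks with entries in `{0, ±1}`

Second step of the constant-free completeness proof for the permanent behind Bürgisser 2009,
Thm. 2.10 (`ConstantFreeCompleteness.lean`): every local factor of the parse-tree expansion of
a `VP⁰` circuit (sibling files) has to be written as the permanent of a small matrix whose
entries are `0, ±1`, labels `X_v` / constants, and the Boolean variables of the factor, EACH
VARIABLE OCCURRING EXACTLY ONCE (so that, with its second occurrence in another factor, it has
the two sites required by the Boolean-sum gadget of `PermanentBooleanSum.lean`). This is the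
role played by the universality of the permanent for formulas in the classical proof
(Bürgisser–Clausen–Shokrollahi 1997, Thm. (21.27)); for the handful of factor shapes needed we
give explicit blocks (found by computer search, verified here by expansion):

* `Kit.mulBlock p₁ p₂ t` (`4 × 4`): `per = (1 - p₁)(1 - p₂) + t (p₁ + p₂ - 1)`, i.e.
  `[p₁ = t][p₂ = t]` on Boolean inputs (a product gate passes its demand `t` to both children);
* `Kit.addBlock t p₁ p₂` (`6 × 6`): `per = (1 - p₁)(1 - p₂) + t (2p₁ + 2p₂ - 3p₁p₂ - 1)`, i.e.
  `[t = 0][p₁ = p₂ = 0] + [t = 1][p₁ + p₂ = 1]` (a sum gate passes its demand to exactly one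
  child; no `5 × 5` block exists: the coefficient `-3` of `t p₁ p₂` would be a `2 × 2`
  permanent with entries in `{0, ±1}`);
* `Kit.passBlock c p t` (`4 × 4`, the coefficient `c` an entry): `per = (1 - p)(1 - t) + c p t`;
* `Kit.eqBlock a b` (`4 × 4`): `per = 1 - a - b + 2ab = [a = b]`;
* `Kit.leafBlock ℓ t` (`3 × 3`, the label `ℓ` an entry): `per = 1 + t (ℓ - 1) = ℓ^t`.

and two generic one-vertex constructions (deliberate dot-notation extensions of `Matrix`):

* `Matrix.seriesAt M c y` with `Matrix.permanent_seriesAt`: routing a site `(r, c)` through a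
  new vertex `z` (loop `1`, edge `z → c` of weight `y`, the site moved to `(r, z)`) multiplies
  its weight by `y` — `per (seriesAt M c y + x E_{(r,z)}) = per (M + (x y) E_{rc})`;
* `Matrix.permanent_seriesAt_split` (`y = 1`, old site kept): two sites `s E_{rc} + x E_{(r,z)}`
  act as one site of weight `s + x` — the OR-split by which a block reads any number of
  incoming token variables, each exactly once (on inputs with at most one `1` the sum is the OR);
* `Matrix.permanent_fromBlocks_zero₁₂`;

and, in the `Kit` namespace, the iterated OR-split as an `∃`-scheme (`Kit.exists_orSplitScheme`,
`Kit.exists_cellSplitN`, in the style of `exists_boolSumScheme`) and the blocks with `n`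
incoming tokens `Kit.exists_{mul,add,pass,leaf,chain0,chain}BlockN`, `Kit.exists_topBlock`,
`Kit.exists_finBlock`. Only the `Matrix.*` lemmas above (all taking a matrix argument) are
deliberate dot-notation extensions of Mathlib's `Matrix` namespace.

## References

* P. Bürgisser, M. Clausen, M. A. Shokrollahi, *Algebraic Complexity Theory*, Springer 1997,
  Thm. (21.27) (universality of the permanent), proof of Thm. (21.29).
* L. G. Valiant, *Completeness classes in algebra*, STOC 1979, §2.
* P. Bürgisser, *On defining integers and proving arithmetic circuit lower bounds*, Comput.
  Complexity 18 (2009), proof of Thm. 2.10.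
-/

namespace Matrix

open Equiv Finset

variable {ι : Type*} [Fintype ι] [DecidableEq ι] {R : Type*} [CommRing R]

/-! ### One more vertex: the series / OR-split construction -/

/-- `per (A 0; C D) = per A · per D` (the transpose of `Matrix.permanent_fromBlocks_zero₂₁`). [folklore] -/
theorem permanent_fromBlocks_zero₁₂ {m n : Type*} [Fintype m] [DecidableEq m] [Fintype n]
    [DecidableEq n] (A : Matrix m m R) (C : Matrix n m R) (D : Matrix n n R) :
    (Matrix.fromBlocks A 0 C D).permanent = A.permanent * D.permanent := by
  rw [← permanent_transpose, fromBlocks_transpose, transpose_zero, permanent_fromBlocks_zero₂₁,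
    permanent_transpose, permanent_transpose]

/-- **The series vertex.** One new vertex `z` with a loop of weight `1` and an edge `z → c` of
weight `y`; the edge `r → z` (weight `x`) is added as a site `x E_{(r, z)}`. [folklore] -/
def seriesAt (M : Matrix ι ι R) (c : ι) (y : R) : Matrix (ι ⊕ Unit) (ι ⊕ Unit) R :=
  fromBlocks M 0 (of fun _ j => if j = c then y else 0) (of fun _ _ => 1)

omit [Fintype ι] in
/-- Entries of the series construction. [folklore] -/
@[simp] theorem seriesAt_inl_inl (M : Matrix ι ι R) (c : ι) (y : R) (i j : ι) :
    seriesAt M c y (Sum.inl i) (Sum.inl j) = M i j := rfl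

omit [Fintype ι] in
/-- Entries of the series construction. [folklore] -/
@[simp] theorem seriesAt_inl_inr (M : Matrix ι ι R) (c : ι) (y : R) (i : ι) (z : Unit) :
    seriesAt M c y (Sum.inl i) (Sum.inr z) = 0 := rfl

omit [Fintype ι] in
/-- Entries of the series construction. [folklore] -/
@[simp] theorem seriesAt_inr_inl (M : Matrix ι ι R) (c : ι) (y : R) (z : Unit) (j : ι) :
    seriesAt M c y (Sum.inr z) (Sum.inl j) = if j = c then y else 0 := rfl

omit [Fintype ι] in
/-- Entries of the series construction. [folklore] -/
@[simp] theorem seriesAt_inr_inr (M : Matrix ι ι R) (c : ι) (y : R) (z z' : Unit) :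
    seriesAt M c y (Sum.inr z) (Sum.inr z') = 1 := rfl

omit [Fintype ι] in
/-- The series construction is additive in the base matrix. [folklore] -/
theorem seriesAt_add (M N : Matrix ι ι R) (c : ι) (y : R) :
    seriesAt (M + N) c y = seriesAt M c y + fromBlocks N 0 0 (0 : Matrix Unit Unit R) := by
  ext x x'
  rcases x with i | z <;> rcases x' with j | z' <;> simp [seriesAt]

/-- **Series substitution**: routing the site `(r, c)` through the new vertex multiplies its
weight: `per (seriesAt M c y + x E_{(r,z)}) = per (M + (x y) E_{rc})` (the covers either take
the loop at `z`, or the path `r → z → c`). [folklore] -/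
theorem permanent_seriesAt (M : Matrix ι ι R) (r c : ι) (y x : R) :
    (seriesAt M c y + single (Sum.inl r) (Sum.inr ()) x).permanent =
      (M + single r c (x * y)).permanent := by
  rw [permanent_add_single, permanent_add_single]
  have hper : (seriesAt M c y).permanent = M.permanent := by
    rw [seriesAt, permanent_fromBlocks_zero₁₂]
    simp
  have hsub : (seriesAt M c y).subperm (fun i => i ≠ Sum.inr ()) (fun j => j ≠ Sum.inl r) =
      y * M.subperm (fun i => i ≠ c) (fun j => j ≠ r) := by
    rw [(seriesAt M c y).subperm_row_one (Sum.inr ()) (Sum.inl c) (by simp) (by simp)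
      (by
        rintro (j | z) hp hne
        · have hj : j ≠ c := fun h => hne (by rw [h])
          simp [hj]
        · exact absurd rfl hp)]
    rw [seriesAt_inr_inl, if_pos rfl, seriesAt,
      subperm_fromBlocks_of_inl _ _ _ _ _ _ (by simp) (by simp)]
    congr 1
    exact M.subperm_congr (fun i => by simp) (fun j => by simp)
  rw [hper, hsub]
  ring

/-- **OR-split**: with `y = 1` and the old site kept, the two sites `s E_{rc}` and
`x E_{(r,z)}` add up: `per = per (M + (s + x) E_{rc})`. Iterated, this lets a block read the
sum (the OR, on inputs with at most one `1`) of any number of incoming token variables, each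
at its own site. [folklore] -/
theorem permanent_seriesAt_split (M : Matrix ι ι R) (r c : ι) (s x : R) :
    (seriesAt M c 1 + single (Sum.inl r) (Sum.inl c) s + single (Sum.inl r) (Sum.inr ()) x).permanent =
      (M + single r c (s + x)).permanent := by
  have h : seriesAt M c 1 + single (Sum.inl r) (Sum.inl c) s = seriesAt (M + single r c s) c 1 := by
    rw [seriesAt_add]
    congr 1
    ext x x'
    rcases x with i | z <;> rcases x' with j | z' <;> simp [single_apply]
  rw [h, permanent_seriesAt, mul_one, add_assoc, single_add]

end Matrix

/-! ### The base blocks of the kit and their permanents -/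

namespace Literature.Computability.AlgebraicComplexity

namespace Kit

open _root_.Matrix

variable {R : Type*} [CommRing R]

universe u

/-! ### Splitting a cell into token sites -/

/-- **Iterated OR-split (scheme).** For a cell `(r, c)` and `n` further token variables there
are an index type `κ` (`#κ = #ι + n`), an embedding `e : ι ↪ κ`, a constant matrix `C` with
entries in `{0, 1}` vanishing on the image block, and cells `cell i` (all in the row `e r`,
off the image columns) such that for EVERY `A`, `s` and `x`,
`per (C + extendAlong e (A + s E_{rc}) + ∑_i x_i E_{(e r, cell i)}) = per (A + (s + ∑_i x_i) E_{rc})`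
(`n` series vertices with `y = 1`, `Matrix.permanent_seriesAt_split`). Stated for an index type in
any universe `u` (the kit uses `Type`). [folklore] -/
theorem exists_orSplitScheme {ι : Type u} [Fintype ι] [DecidableEq ι] (r c : ι) : ∀ n : ℕ,
    ∃ (κ : Type u) (_ : Fintype κ) (_ : DecidableEq κ) (e : ι ↪ κ) (C : Matrix κ κ R)
      (cell : Fin n → κ),
      Fintype.card κ = Fintype.card ι + n ∧ (∀ x y, C x y = 0 ∨ C x y = 1) ∧
      (∀ i j, C (e i) (e j) = 0) ∧ (∀ i j, cell i ≠ e j) ∧ Function.Injective cell ∧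
      ∀ (A : Matrix ι ι R) (s : R) (x : Fin n → R),
        (C + extendAlong e (A + single r c s) + ∑ i, single (e r) (cell i) (x i)).permanent =
          (A + single r c (s + ∑ i, x i)).permanent
  | 0 => ⟨ι, inferInstance, inferInstance, Function.Embedding.refl ι, 0, Fin.elim0, by simp,
      fun _ _ => Or.inl rfl, fun _ _ => rfl, fun i => Fin.elim0 i,
      fun i => Fin.elim0 i, fun A s x => by simp⟩
  | n + 1 => by
    obtain ⟨κ, _, _, e, C, cell, hcard, hC, hC0, hcell, hinj, hper⟩ := exists_orSplitScheme r c n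
    refine ⟨κ ⊕ Unit, inferInstance, inferInstance, e.trans ⟨Sum.inl, Sum.inl_injective⟩,
      seriesAt C (e c) 1, Fin.snoc (fun i => Sum.inl (cell i)) (Sum.inr ()), ?_, ?_, ?_, ?_, ?_, ?_⟩
    · simp [Fintype.card_sum, hcard, add_assoc]
    · rintro (x | z) (y | z')
      · simpa using hC x y
      · simp
      · simp only [seriesAt_inr_inl]
        split_ifs
        exacts [Or.inr rfl, Or.inl rfl]
      · simp
    · intro i j
      simpa using hC0 i j
    · intro i j
      refine Fin.lastCases ?_ (fun i => ?_) i
      · simp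
      · simpa using hcell i j
    · intro i i' h
      induction i using Fin.lastCases with
      | last =>
        induction i' using Fin.lastCases with
        | last => rfl
        | cast i' => simp at h
      | cast i =>
        induction i' using Fin.lastCases with
        | last => simp at h
        | cast i' =>
          simp only [Fin.snoc_castSucc, Sum.inl.injEq] at h
          rw [hinj h]
    · intro A s x
      rw [Fin.sum_univ_castSucc, Fin.sum_univ_castSucc]
      simp only [Fin.snoc_castSucc, Fin.snoc_last, Function.Embedding.trans_apply,
        Function.Embedding.coeFn_mk]
      -- move everything but the last site inside the series construction
      have hin : seriesAt C (e c) 1 + extendAlong (e.trans ⟨Sum.inl, Sum.inl_injective⟩)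
            (A + single r c s) + ∑ i : Fin n, single (Sum.inl (e r)) (Sum.inl (cell i)) (x i.castSucc) =
          seriesAt (C + extendAlong e (A + single r c s) +
            ∑ i : Fin n, single (e r) (cell i) (x i.castSucc)) (e c) 1 := by
        rw [seriesAt_add, seriesAt_add, extendAlong_trans_inl]
        congr 1
        ext a b
        rcases a with a | z <;> rcases b with b | z' <;>
          simp [Matrix.sum_apply, single_apply]
      rw [← add_assoc, hin]
      -- the base matrix has the site `(e r, e c)` with current weight: split off `x (last n)`
      have key := permanent_seriesAt (C + extendAlong e (A + single r c s) +
        ∑ i : Fin n, single (e r) (cell i) (x i.castSucc)) (e r) (e c) 1 (x (Fin.last n))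
      rw [mul_one] at key
      rw [key]
      have hmove : C + extendAlong e (A + single r c s) + ∑ i : Fin n, single (e r) (cell i) (x i.castSucc) +
            single (e r) (e c) (x (Fin.last n)) =
          C + extendAlong e (A + single r c (s + x (Fin.last n))) +
            ∑ i : Fin n, single (e r) (cell i) (x i.castSucc) := by
        rw [← extendAlong_single e, single_add]
        simp only [extendAlong_add]
        abel
      rw [hmove, hper A (s + x (Fin.last n)) (fun i => x i.castSucc)]
      congr 2
      ring

/-- The **product block** `[p₁ = t][p₂ = t]` (read-once in `p₁, p₂, t`; entries in `{0, ±1}`):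
found by computer search, verified by `permanent_mulBlock`. [folklore] -/
def mulBlock (p₁ p₂ t : R) : Matrix (Fin 4) (Fin 4) R :=
  !![p₁, -1, -1, -1; 0, p₂, 0, -1; 0, -1, t, -1; -1, -1, -1, 0]

/-- `per (mulBlock p₁ p₂ t) = (1 - p₁)(1 - p₂) + t (p₁ + p₂ - 1)`; on Boolean inputs this is
`[p₁ = t][p₂ = t]`. [folklore] -/
theorem permanent_mulBlock (p₁ p₂ t : R) :
    (mulBlock p₁ p₂ t).permanent = (1 - p₁) * (1 - p₂) + t * (p₁ + p₂ - 1) := by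
  rw [mulBlock, permanent_fin_four_row]
  simp
  ring

/-- The **coefficient block** `[t = 0][p = 0] + [t = 1] c [p = 1]` with the coefficient `c` as
an entry (read-once in `p, t`; other entries in `{0, ±1}`). [folklore] -/
def passBlock (c p t : R) : Matrix (Fin 4) (Fin 4) R :=
  !![p, 0, 0, -1; 0, t, -1, 0; -1, 0, c, -1; 0, -1, -1, 1]

/-- `per (passBlock c p t) = (1 - p)(1 - t) + c p t`. [folklore] -/
theorem permanent_passBlock (c p t : R) :
    (passBlock c p t).permanent = (1 - p) * (1 - t) + c * p * t := by
  rw [passBlock, permanent_fin_four_row]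
  simp
  ring

/-- The **equality block** `[a = b]` (read-once in `a, b`; entries in `{0, ±1}`). [folklore] -/
def eqBlock (a b : R) : Matrix (Fin 4) (Fin 4) R :=
  !![a, -1, -1, 0; 0, b, 0, -1; 0, 0, -1, -1; -1, -1, -1, -1]

/-- `per (eqBlock a b) = 1 - a - b + 2ab`; on Boolean inputs this is `[a = b]`. [folklore] -/
theorem permanent_eqBlock (a b : R) :
    (eqBlock a b).permanent = 1 - a - b + 2 * a * b := by
  rw [eqBlock, permanent_fin_four_row]
  simp
  ring

/-- The **leaf block** `1 + t (ℓ - 1)` (`= ℓ^t` for Boolean `t`) with the label `ℓ` as an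
entry. [folklore] -/
def leafBlock (ℓ t : R) : Matrix (Fin 3) (Fin 3) R :=
  !![t, 1, 0; 1, ℓ, 1; 0, -1, 1]

/-- `per (leafBlock ℓ t) = 1 + t (ℓ - 1)`. [folklore] -/
theorem permanent_leafBlock (ℓ t : R) : (leafBlock ℓ t).permanent = 1 + t * (ℓ - 1) := by
  rw [leafBlock, permanent_fin_three_row]
  simp
  ring

/-- The **addition block** `[t = 0][p₁ = p₂ = 0] + [t = 1][p₁ + p₂ = 1]` (read-once in
`t, p₁, p₂`; entries in `{0, ±1}`; `6 × 6` — a `5 × 5` block is impossible, its `t p₁ p₂`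
coefficient `-3` being a `2 × 2` permanent). [folklore] -/
def addBlock (t p₁ p₂ : R) : Matrix (Fin 6) (Fin 6) R :=
  !![t, 0, -1, -1, 1, -1; 0, p₁, 0, 0, -1, 0; 0, 1, p₂, 1, -1, 0; 0, 1, 1, -1, 0, -1;
    -1, -1, -1, 0, -1, -1; -1, -1, 0, -1, -1, -1]

/-- `per (addBlock t p₁ p₂) = (1 - p₁)(1 - p₂) + t (2p₁ + 2p₂ - 3p₁p₂ - 1)`: expansion along
the sparse row `1`, then along a sparse row of the two `5 × 5` minors. [folklore] -/
theorem permanent_addBlock (t p₁ p₂ : R) :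
    (addBlock t p₁ p₂).permanent =
      (1 - p₁) * (1 - p₂) + t * (2 * p₁ + 2 * p₂ - 3 * p₁ * p₂ - 1) := by
  rw [permanent_eq_sum_row_subset (addBlock t p₁ p₂) 1 {1, 4}
    (by intro j hj; fin_cases j <;> simp_all [addBlock]), Finset.sum_pair (by decide)]
  have e11 : (addBlock t p₁ p₂).submatrix (Fin.succAbove 1) (Fin.succAbove 1) =
      !![t, -1, -1, 1, -1; 0, p₂, 1, -1, 0; 0, 1, -1, 0, -1; -1, -1, 0, -1, -1; -1, 0, -1, -1, -1] := by
    ext i j; fin_cases i <;> fin_cases j <;> rfl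
  have e14 : (addBlock t p₁ p₂).submatrix (Fin.succAbove 1) (Fin.succAbove 4) =
      !![t, 0, -1, -1, -1; 0, 1, p₂, 1, 0; 0, 1, 1, -1, -1; -1, -1, -1, 0, -1; -1, -1, 0, -1, -1] := by
    ext i j; fin_cases i <;> fin_cases j <;> rfl
  have a11 : addBlock t p₁ p₂ 1 1 = p₁ := rfl
  have a14 : addBlock t p₁ p₂ 1 4 = -1 := rfl
  rw [e11, e14, a11, a14]
  -- the two `5 × 5` minors, along their row `1`
  set S₁ : Matrix (Fin 5) (Fin 5) R :=
    !![t, -1, -1, 1, -1; 0, p₂, 1, -1, 0; 0, 1, -1, 0, -1; -1, -1, 0, -1, -1; -1, 0, -1, -1, -1] with hS₁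
  set S₂ : Matrix (Fin 5) (Fin 5) R :=
    !![t, 0, -1, -1, -1; 0, 1, p₂, 1, 0; 0, 1, 1, -1, -1; -1, -1, -1, 0, -1; -1, -1, 0, -1, -1] with hS₂
  rw [permanent_eq_sum_row_subset S₁ 1 {1, 2, 3} (by intro j hj; fin_cases j <;> simp_all),
    permanent_eq_sum_row_subset S₂ 1 {1, 2, 3} (by intro j hj; fin_cases j <;> simp_all),
    Finset.sum_insert (by decide), Finset.sum_pair (by decide),
    Finset.sum_insert (by decide), Finset.sum_pair (by decide)]
  have m11 : S₁.submatrix (Fin.succAbove 1) (Fin.succAbove 1) =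
      !![t, -1, 1, -1; 0, -1, 0, -1; -1, 0, -1, -1; -1, -1, -1, -1] := by
    ext i j; fin_cases i <;> fin_cases j <;> rfl
  have m12 : S₁.submatrix (Fin.succAbove 1) (Fin.succAbove 2) =
      !![t, -1, 1, -1; 0, 1, 0, -1; -1, -1, -1, -1; -1, 0, -1, -1] := by
    ext i j; fin_cases i <;> fin_cases j <;> rfl
  have m13 : S₁.submatrix (Fin.succAbove 1) (Fin.succAbove 3) =
      !![t, -1, -1, -1; 0, 1, -1, -1; -1, -1, 0, -1; -1, 0, -1, -1] := by
    ext i j; fin_cases i <;> fin_cases j <;> rfl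
  have n11 : S₂.submatrix (Fin.succAbove 1) (Fin.succAbove 1) =
      !![t, -1, -1, -1; 0, 1, -1, -1; -1, -1, 0, -1; -1, 0, -1, -1] := by
    ext i j; fin_cases i <;> fin_cases j <;> rfl
  have n12 : S₂.submatrix (Fin.succAbove 1) (Fin.succAbove 2) =
      !![t, 0, -1, -1; 0, 1, -1, -1; -1, -1, 0, -1; -1, -1, -1, -1] := by
    ext i j; fin_cases i <;> fin_cases j <;> rfl
  have n13 : S₂.submatrix (Fin.succAbove 1) (Fin.succAbove 3) =
      !![t, 0, -1, -1; 0, 1, 1, -1; -1, -1, -1, -1; -1, -1, 0, -1] := by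
    ext i j; fin_cases i <;> fin_cases j <;> rfl
  have s11 : S₁ 1 1 = p₂ := rfl
  have s12 : S₁ 1 2 = 1 := rfl
  have s13 : S₁ 1 3 = -1 := rfl
  have r11 : S₂ 1 1 = 1 := rfl
  have r12 : S₂ 1 2 = p₂ := rfl
  have r13 : S₂ 1 3 = 1 := rfl
  rw [m11, m12, m13, n11, n12, n13, s11, s12, s13, r11, r12, r13]
  simp only [permanent_fin_four_row]
  simp
  ring

/-! ### The blocks with `n` incoming tokens -/

section NBlocks

/-- Entries of an extended matrix. [folklore] -/
theorem forall_extendAlong (P : R → Prop) (h0 : P 0) {ι κ : Type*} (e : ι ↪ κ) (A : Matrix ι ι R)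
    (hA : ∀ i j, P (A i j)) : ∀ x y, P (extendAlong e A x y) := by
  intro x y
  by_cases hx : ∃ i, e i = x
  · obtain ⟨i, rfl⟩ := hx
    by_cases hy : ∃ j, e j = y
    · obtain ⟨j, rfl⟩ := hy
      rw [extendAlong_apply_image]
      exact hA i j
    · rw [extendAlong_apply_of_col _ _ _ (fun j hj => hy ⟨j, hj⟩)]
      exact h0
  · rw [extendAlong_apply_of_row _ _ _ (fun i hi => hx ⟨i, hi⟩)]
    exact h0

/-- Entries of a sum with a `{0,1}`-matrix vanishing where the other lives. [folklore] -/
theorem forall_add_of_disjoint (P : R → Prop) (h0 : P 0) (h1 : P 1) {κ : Type*} (C D : Matrix κ κ R)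
    (hC : ∀ x y, C x y = 0 ∨ C x y = 1) (hD : ∀ x y, P (D x y))
    (hdisj : ∀ x y, C x y = 0 ∨ D x y = 0) : ∀ x y, P ((C + D) x y) := by
  intro x y
  rw [add_apply]
  rcases hdisj x y with h | h
  · rw [h, zero_add]; exact hD x y
  · rw [h, add_zero]
    rcases hC x y with h' | h' <;> rw [h']
    exacts [h0, h1]

/-- **Splitting a cell into `n` token sites (generic).** For a base matrix `A₀` on `ι` and a
cell `(r, c)` read with coefficient `ε`: an index type `κ` (`#κ = #ι + n`), a matrix `M`
(entries: those of `A₀`, `0`, `1`), an embedding `e` and `n` cells in the row `e r` such that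
for every further matrix `D` on `ι` (the other sites) and all token values `t`,
`per (M + extendAlong e D + ∑_i (ε t_i) E_{(e r, cell_i)}) = per (A₀ + D + (ε ∑_i t_i) E_{rc})`. [folklore] -/
theorem exists_cellSplitN (P : R → Prop) (h0 : P 0) (h1 : P 1) {ι : Type} [Fintype ι]
    [DecidableEq ι] (A₀ : Matrix ι ι R) (hA : ∀ i j, P (A₀ i j)) (r c : ι) (ε : R) (n : ℕ) :
    ∃ (κ : Type) (_ : Fintype κ) (_ : DecidableEq κ) (M : Matrix κ κ R) (e : ι ↪ κ)
      (cell : Fin n → κ),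
      Fintype.card κ = Fintype.card ι + n ∧ (∀ x y, P (M x y)) ∧
      ∀ (D : Matrix ι ι R) (t : Fin n → R),
        (M + extendAlong e D + ∑ i, single (e r) (cell i) (ε * t i)).permanent =
          (A₀ + D + single r c (ε * ∑ i, t i)).permanent := by
  obtain ⟨κ, _, _, e, C, cell, hcard, hC, hC0, -, -, hper⟩ := exists_orSplitScheme (R := R) r c n
  refine ⟨κ, inferInstance, inferInstance, C + extendAlong e A₀, e, cell, hcard, ?_, fun D t => ?_⟩
  · refine forall_add_of_disjoint P h0 h1 C _ hC (forall_extendAlong P h0 e _ hA) (fun x y => ?_)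
    by_cases hx : ∃ i, e i = x
    · obtain ⟨i, rfl⟩ := hx
      by_cases hy : ∃ j, e j = y
      · obtain ⟨j, rfl⟩ := hy
        exact Or.inl (hC0 i j)
      · exact Or.inr (extendAlong_apply_of_col _ _ _ (fun j hj => hy ⟨j, hj⟩))
    · exact Or.inr (extendAlong_apply_of_row _ _ _ (fun i hi => hx ⟨i, hi⟩))
  · have h := hper (A₀ + D) 0 (fun i => ε * t i)
    rw [single_zero, add_zero, zero_add, ← Finset.mul_sum] at h
    rw [← h, extendAlong_add]
    congr 2
    abel

/-- The product block decomposes into its constant part and its three sites. [folklore] -/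
theorem mulBlock_eq (p₁ p₂ t : R) :
    mulBlock p₁ p₂ t = mulBlock 0 0 0 + (single 0 0 p₁ + single 1 1 p₂) + single 2 2 t := by
  ext i j
  fin_cases i <;> fin_cases j <;> simp [mulBlock]

/-- **Product block with `n` incoming tokens**: sites for `p₁, p₂` and one per token, all with
coefficient `1`, entries in `{0, ±1}`, size `4 + n`, and
`per = (1 - p₁)(1 - p₂) + (∑ t_i)(p₁ + p₂ - 1)`. [folklore] -/
theorem exists_mulBlockN (P : R → Prop) (h0 : P 0) (h1 : P 1) (hn1 : P (-1)) (n : ℕ) :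
    ∃ (κ : Type) (_ : Fintype κ) (_ : DecidableEq κ) (M : Matrix κ κ R) (sp₁ sp₂ : κ × κ)
      (st : Fin n → κ × κ),
      Fintype.card κ = 4 + n ∧ (∀ x y, P (M x y)) ∧
      ∀ (p₁ p₂ : R) (t : Fin n → R),
        (M + single sp₁.1 sp₁.2 p₁ + single sp₂.1 sp₂.2 p₂ +
            ∑ i, single (st i).1 (st i).2 (t i)).permanent =
          (1 - p₁) * (1 - p₂) + (∑ i, t i) * (p₁ + p₂ - 1) := by
  obtain ⟨κ, _, _, M, e, cell, hcard, hM, hper⟩ := exists_cellSplitN P h0 h1 (mulBlock (0 : R) 0 0)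
    (fun i j => by fin_cases i <;> fin_cases j <;> simp [mulBlock, h0, hn1]) 2 2 1 n
  refine ⟨κ, inferInstance, inferInstance, M, (e 0, e 0), (e 1, e 1), fun i => (e 2, cell i),
    by simpa using hcard, hM, fun p₁ p₂ t => ?_⟩
  have h := hper (single 0 0 p₁ + single 1 1 p₂) t
  simp only [one_mul] at h
  rw [← mulBlock_eq, permanent_mulBlock] at h
  rw [← h, extendAlong_add, extendAlong_single, extendAlong_single]
  congr 2
  abel

/-- The addition block decomposes into its constant part and its three sites. [folklore] -/
theorem addBlock_eq (t p₁ p₂ : R) :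
    addBlock t p₁ p₂ = addBlock 0 0 0 + (single 1 1 p₁ + single 2 2 p₂) + single 0 0 t := by
  ext i j
  fin_cases i <;> fin_cases j <;> simp [addBlock]

/-- **Addition block with `n` incoming tokens**: size `6 + n`, entries in `{0, ±1}`,
`per = (1 - p₁)(1 - p₂) + (∑ t_i)(2p₁ + 2p₂ - 3p₁p₂ - 1)`. [folklore] -/
theorem exists_addBlockN (P : R → Prop) (h0 : P 0) (h1 : P 1) (hn1 : P (-1)) (n : ℕ) :
    ∃ (κ : Type) (_ : Fintype κ) (_ : DecidableEq κ) (M : Matrix κ κ R) (sp₁ sp₂ : κ × κ)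
      (st : Fin n → κ × κ),
      Fintype.card κ = 6 + n ∧ (∀ x y, P (M x y)) ∧
      ∀ (p₁ p₂ : R) (t : Fin n → R),
        (M + single sp₁.1 sp₁.2 p₁ + single sp₂.1 sp₂.2 p₂ +
            ∑ i, single (st i).1 (st i).2 (t i)).permanent =
          (1 - p₁) * (1 - p₂) + (∑ i, t i) * (2 * p₁ + 2 * p₂ - 3 * p₁ * p₂ - 1) := by
  obtain ⟨κ, _, _, M, e, cell, hcard, hM, hper⟩ := exists_cellSplitN P h0 h1 (addBlock (0 : R) 0 0)
    (fun i j => by fin_cases i <;> fin_cases j <;> simp [addBlock, h0, h1, hn1]) 0 0 1 n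
  refine ⟨κ, inferInstance, inferInstance, M, (e 1, e 1), (e 2, e 2), fun i => (e 0, cell i),
    by simpa using hcard, hM, fun p₁ p₂ t => ?_⟩
  have h := hper (single 1 1 p₁ + single 2 2 p₂) t
  simp only [one_mul] at h
  rw [← addBlock_eq, permanent_addBlock] at h
  rw [← h, extendAlong_add, extendAlong_single, extendAlong_single]
  congr 2
  abel

/-- The coefficient block decomposes into its constant part and its two sites. [folklore] -/
theorem passBlock_eq (c p t : R) :
    passBlock c p t = passBlock c 0 0 + single 0 0 p + single 1 1 t := by
  ext i j
  fin_cases i <;> fin_cases j <;> simp [passBlock]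

/-- **Coefficient block with `n` incoming tokens**: size `4 + n`, entries in `{0, ±1, c}`,
`per = (1 - p)(1 - ∑ t_i) + c p ∑ t_i`. [folklore] -/
theorem exists_passBlockN (P : R → Prop) (h0 : P 0) (h1 : P 1) (hn1 : P (-1)) (c : R)
    (hc : P c) (n : ℕ) :
    ∃ (κ : Type) (_ : Fintype κ) (_ : DecidableEq κ) (M : Matrix κ κ R) (sp : κ × κ)
      (st : Fin n → κ × κ),
      Fintype.card κ = 4 + n ∧ (∀ x y, P (M x y)) ∧
      ∀ (p : R) (t : Fin n → R),
        (M + single sp.1 sp.2 p + ∑ i, single (st i).1 (st i).2 (t i)).permanent =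
          (1 - p) * (1 - ∑ i, t i) + c * p * ∑ i, t i := by
  obtain ⟨κ, _, _, M, e, cell, hcard, hM, hper⟩ := exists_cellSplitN P h0 h1 (passBlock c (0 : R) 0)
    (fun i j => by fin_cases i <;> fin_cases j <;> simp [passBlock, h0, h1, hn1, hc]) 1 1 1 n
  refine ⟨κ, inferInstance, inferInstance, M, (e 0, e 0), fun i => (e 1, cell i),
    by simpa using hcard, hM, fun p t => ?_⟩
  have h := hper (single 0 0 p) t
  simp only [one_mul] at h
  rw [← passBlock_eq, permanent_passBlock] at h
  rw [← h, extendAlong_single]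

/-- The leaf block decomposes into its constant part and its site. [folklore] -/
theorem leafBlock_eq (ℓ t : R) : leafBlock ℓ t = leafBlock ℓ 0 + 0 + single 0 0 t := by
  ext i j
  fin_cases i <;> fin_cases j <;> simp [leafBlock]

/-- **Leaf block with `n` incoming tokens**: size `3 + n`, entries in `{0, ±1, ℓ}`,
`per = 1 + (∑ t_i)(ℓ - 1)` (`= ℓ` if one token is set, `1` if none). [folklore] -/
theorem exists_leafBlockN (P : R → Prop) (h0 : P 0) (h1 : P 1) (hn1 : P (-1)) (ℓ : R)
    (hℓ : P ℓ) (n : ℕ) :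
    ∃ (κ : Type) (_ : Fintype κ) (_ : DecidableEq κ) (M : Matrix κ κ R) (st : Fin n → κ × κ),
      Fintype.card κ = 3 + n ∧ (∀ x y, P (M x y)) ∧
      ∀ t : Fin n → R,
        (M + ∑ i, single (st i).1 (st i).2 (t i)).permanent = 1 + (∑ i, t i) * (ℓ - 1) := by
  obtain ⟨κ, _, _, M, e, cell, hcard, hM, hper⟩ := exists_cellSplitN P h0 h1 (leafBlock ℓ (0 : R))
    (fun i j => by fin_cases i <;> fin_cases j <;> simp [leafBlock, h0, h1, hn1, hℓ]) 0 0 1 n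
  refine ⟨κ, inferInstance, inferInstance, M, fun i => (e 0, cell i), by simpa using hcard, hM,
    fun t => ?_⟩
  have h := hper 0 t
  simp only [one_mul] at h
  rw [← leafBlock_eq, permanent_leafBlock] at h
  rw [← h, extendAlong]
  congr 2
  ext x y
  simp

/-- The equality block decomposes into its constant part and its two sites. [folklore] -/
theorem eqBlock_eq (a b : R) : eqBlock a b = eqBlock 0 0 + single 0 0 a + single 1 1 b := by
  ext i j
  fin_cases i <;> fin_cases j <;> simp [eqBlock]

/-- **Chain-start block** `[a = ¬(t₁ ∨ … ∨ t_n)]`: `eqBlock a (1 - ∑ t_i)`, the tokens read with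
coefficient `-1`; size `4 + n`, entries in `{0, ±1}`, `per = a + ∑ t_i - 2 a ∑ t_i`. [folklore] -/
theorem exists_chain0BlockN (P : R → Prop) (h0 : P 0) (h1 : P 1) (hn1 : P (-1)) (n : ℕ) :
    ∃ (κ : Type) (_ : Fintype κ) (_ : DecidableEq κ) (M : Matrix κ κ R) (sa : κ × κ)
      (st : Fin n → κ × κ),
      Fintype.card κ = 4 + n ∧ (∀ x y, P (M x y)) ∧
      ∀ (a : R) (t : Fin n → R),
        (M + single sa.1 sa.2 a + ∑ i, single (st i).1 (st i).2 (-1 * t i)).permanent =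
          a + (∑ i, t i) - 2 * a * ∑ i, t i := by
  obtain ⟨κ, _, _, M, e, cell, hcard, hM, hper⟩ := exists_cellSplitN P h0 h1 (eqBlock (0 : R) 1)
    (fun i j => by fin_cases i <;> fin_cases j <;> simp [eqBlock, h0, h1, hn1]) 1 1 (-1) n
  refine ⟨κ, inferInstance, inferInstance, M, (e 0, e 0), fun i => (e 1, cell i),
    by simpa using hcard, hM, fun a t => ?_⟩
  have h := hper (single 0 0 a) t
  have hm : eqBlock (0 : R) 1 + single 0 0 a + single 1 1 (-1 * ∑ i, t i) = eqBlock a (1 - ∑ i, t i) := by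
    rw [eqBlock_eq a, eqBlock_eq 0 1, single_zero, add_zero, sub_eq_add_neg, single_add, neg_one_mul]
    abel
  rw [hm, permanent_eqBlock, extendAlong_single] at h
  simp only []
  rw [h]
  ring

/-- **Chain block** `[a = a' ∧ ¬(t₁ ∨ … ∨ t_n)]`: `eqBlock a (a' (1 - ∑ t_i))`, realised by a
series vertex (`a'` on the edge into it, `1 - ∑ t_i` on the edge out of it); size `5 + n`,
entries in `{0, ±1}`, tokens read with coefficient `-1`. [folklore] -/
theorem exists_chainBlockN (P : R → Prop) (h0 : P 0) (h1 : P 1) (hn1 : P (-1)) (n : ℕ) :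
    ∃ (κ : Type) (_ : Fintype κ) (_ : DecidableEq κ) (M : Matrix κ κ R) (sa' sa : κ × κ)
      (st : Fin n → κ × κ),
      Fintype.card κ = 5 + n ∧ (∀ x y, P (M x y)) ∧
      ∀ (a' a : R) (t : Fin n → R),
        (M + single sa'.1 sa'.2 a' + single sa.1 sa.2 a +
            ∑ i, single (st i).1 (st i).2 (-1 * t i)).permanent =
          1 - a - a' * (1 - ∑ i, t i) + 2 * a * (a' * (1 - ∑ i, t i)) := by
  obtain ⟨κ, _, _, M, e, cell, hcard, hM, hper⟩ := exists_cellSplitN P h0 h1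
    (seriesAt (eqBlock (0 : R) 0) 1 1)
    (by
      rintro (i | z) (j | z')
      · fin_cases i <;> fin_cases j <;> simp [eqBlock, h0, hn1]
      · simpa using h0
      · simp only [seriesAt_inr_inl]
        split_ifs
        exacts [h1, h0]
      · simpa using h1)
    (Sum.inr ()) (Sum.inl 1) (-1) n
  refine ⟨κ, inferInstance, inferInstance, M, (e (Sum.inl 1), e (Sum.inr ())),
    (e (Sum.inl 0), e (Sum.inl 0)), fun i => (e (Sum.inr ()), cell i), by simpa using hcard, hM,
    fun a' a t => ?_⟩
  have h := hper (single (Sum.inl 1) (Sum.inr ()) a' + single (Sum.inl 0) (Sum.inl 0) a) t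
  -- the base: `seriesAt (eqBlock a 0) 1 (1 - ∑ t) + a' E_{(1, z)}`
  have hm : seriesAt (eqBlock (0 : R) 0) 1 1 +
        (single (Sum.inl 1) (Sum.inr ()) a' + single (Sum.inl 0) (Sum.inl 0) a) +
        single (Sum.inr ()) (Sum.inl 1) (-1 * ∑ i, t i) =
      seriesAt (eqBlock a 0) 1 (1 - ∑ i, t i) + single (Sum.inl 1) (Sum.inr ()) a' := by
    ext x y
    rcases x with x | z <;> rcases y with y | z'
    · fin_cases x <;> fin_cases y <;> simp [eqBlock]
    · fin_cases x <;> simp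
    · fin_cases y <;> simp [sub_eq_add_neg]
    · simp
  have hm2 : eqBlock a (0 : R) + single 1 1 (a' * (1 - ∑ i, t i)) = eqBlock a (a' * (1 - ∑ i, t i)) := by
    rw [eqBlock_eq a (a' * _), eqBlock_eq a 0, single_zero, add_zero]
  rw [hm, permanent_seriesAt, hm2, permanent_eqBlock, extendAlong_add, extendAlong_single,
    extendAlong_single, ← add_assoc] at h
  simp only []
  rw [h]

/-- **Top block** `[t₀]`: the `1 × 1` matrix `(t₀)`. [folklore] -/
theorem exists_topBlock (P : R → Prop) (h0 : P 0) :
    ∃ (κ : Type) (_ : Fintype κ) (_ : DecidableEq κ) (M : Matrix κ κ R) (s : κ × κ),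
      Fintype.card κ = 1 ∧ (∀ x y, P (M x y)) ∧ ∀ t : R, (M + single s.1 s.2 t).permanent = t :=
  ⟨Fin 1, inferInstance, inferInstance, 0, (0, 0), by simp, fun _ _ => by simpa using h0,
    fun t => by simp⟩

/-- **Chain-end block** `1 + a`: the `1 × 1` matrix `(1 + a)`. [folklore] -/
theorem exists_finBlock (P : R → Prop) (h1 : P 1) :
    ∃ (κ : Type) (_ : Fintype κ) (_ : DecidableEq κ) (M : Matrix κ κ R) (s : κ × κ),
      Fintype.card κ = 1 ∧ (∀ x y, P (M x y)) ∧ ∀ a : R, (M + single s.1 s.2 a).permanent = 1 + a :=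
  ⟨Fin 1, inferInstance, inferInstance, 1, (0, 0), by simp,
    fun x y => by fin_cases x; fin_cases y; simpa using h1, fun a => by simp⟩

end NBlocks

end Kit

end Literature.Computability.AlgebraicComplexity
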